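import Summits.BirchSwinnertonDyer.Rank1Residual.X1.AnomalousPointCount
import Summits.BirchSwinnertonDyer.Rank1Residual.X1.PadicSigmaThreeExistence
import HarnessLib

/-!
# X1 ∩ {r = 1}: the extended certificate-row record with EIGHT binders — the Mazur–Tate sigma binder
# (A34, `mazur_tate_sigma_exists_odd`) DISCHARGED by `mazur_tate_sigma_exists_odd_holds` (x1a gen 20)

HONEST FRAMING (cell `b2b-bsdres`, run/shared/lean/b2b/bsd-rank1-residual/, verbatim in every file):
the goal of the cell is to DELETE the COMBINATION-SHAPED residual classes of the Birch–Swinnerton-Dyer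
formula for ALL analytic-rank `≤ 1` elliptic curves over `ℚ` — "full BSD formula for every rank `≤ 1`
curve in class `C`" assembled STRICTLY from published theorems — so that the rank-`≤ 1` remainder
becomes exactly the CONSTRUCTION-SHAPED classes, which are TYPED (missing-input `Prop`s), NOT
attempted. This is not "finishing BSD". CLASS-OWNERS.md row "X1 (r = 1)": research route; NO CLAIM
BEYOND STATED CLASSES; PER-PAIR certificate shape, not a class theorem; nothing is booked by this file;
no preprint enters; no definition, no named fact.

Unit `b2b-bsdres-x1a` (X1 prover A, gen 20). WHAT. The row record of the N1 lane offer
(`class-closure/N1/OFFER-T-X1R1-RP1-x1a.md`, v1.5: 9 199 / 9 199 rank-one N1/N1′ cells) is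
`RankOne.Leaf.bsdp_of_isIsogenous_of_certificateRowSha_two` (`X1/AnomalousPointCount.lean`, p309788) with
NINE published binders. One of them, `mazur_tate_sigma_exists_odd` (Mazur–Tate 1991 Thm 3.1 / MST 2006
Thm 1.3: existence of the `p`-adic sigma pair at an odd good ordinary prime; registry A34), is now a THEOREM
of the tree: `mazur_tate_sigma_exists_odd_holds` (`X1/PadicSigmaThreeExistence.lean`, x1a gen 20 — `p = 3`
by the chart `Y = 3·x(P)` and the explicit canonical `3`-isogeny, `p ≥ 5` by Blakestad–Grant). This file
records the SAME row records with that binder discharged: `…_certificateRowSha_two'` (booking form) and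
`…mazurMainConjecture_and_bsdp_of_certificateRowSha_two'` (at the pair) take EIGHT named facts — Wuthrich
2014 Thm 16, Perrin-Riou–Schneider (BMS 1.7), Perrin-Riou 1987, modularity ×2, GZK, Cassels, Cassels–Tate.

References: as in `X1/AnomalousPointCount.lean`; HOME/b2b-bsdres-x1a/X1-CHAIN.md §29.

Pure proof file: no definitions, no named facts, no `sorry`.
-/

noncomputable section

open scoped Classical MatrixGroups ModularForm

open PowerSeries CongruenceSubgroup WeierstrassCurve Literature.NumberTheory.EllipticCurves
  Literature.NumberTheory.EllipticCurves.ModularForms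
  Literature.NumberTheory.EllipticCurves.Wuthrich2014
  Literature.NumberTheory.EllipticCurves.Rank1Residual
  Summit.BirchSwinnertonDyer.BirchSwinnertonDyer.Theorems
  Summit.BirchSwinnertonDyer.BirchSwinnertonDyer.Theorems.Rank1ResidualX1Defs
  Summit.BirchSwinnertonDyer.Rank1Residual.X1.RankOneLeadingTermSqueeze
  Summit.BirchSwinnertonDyer.Rank1Residual.X1.PadicSigmaThree

set_option autoImplicit false

namespace Summit.BirchSwinnertonDyer.Rank1Residual.X1

variable {W : WeierstrassCurve ℚ} [W.IsElliptic] [W.IsGloballyMinimal] {p : ℕ} [Fact p.Prime]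

namespace RankOne

/-- **THE EXTENDED ROW RECORD, EIGHT BINDERS (booking form)**: a leaf pair `(E, p)` and a globally minimal
`E′ ∼ E` carrying an extended certificate row (route P₁ ∨ route R with `… ≤ v + ord_p ∏c_ℓ(E′) + 2` ∨
route R-CT₂ with `… + 4` and one non-zero element of `Ш(E′)[p]`) ⇒ `BSD(E,p)` — p309788's record with the
Mazur–Tate sigma binder supplied by `mazur_tate_sigma_exists_odd_holds`.
[cite: Wuthrich2014, Thm. 16 (p. 397)] [cite: BalakrishnanMullerStein2015, Thm. 1.7]
[cite: PerrinRiou1987, §1.4 Cor. 1.8] [cite: SilvermanAEC2009, Thm. X.4.14 and Thm. V.1.1]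
[cite: MilneADT2006, Thm. I.7.3] [cite: MazurSteinTate2006, Thm. 1.3] -/
theorem Leaf.bsdp_of_isIsogenous_of_certificateRowSha_two'
    (hW16 : Wuthrich2014.charIdeal_dvd_padicLFunction) (hS : Schneider1985_order_charGenerator_odd)
    (hPR : perrinRiou_rankOne_leadingTerms_odd)
    (hmod : nonempty_modularParametrizationData) (hmod' : hasEntireLFunction_rat)
    (hGZK : rank_eq_analyticRank_of_analyticRank_le_one) (hCassels : bsdRHS_eq_of_isIsogenous)
    (hCT : exists_casselsTate_pairing (K := ℚ))
    (hL : Leaf W p) {W' : WeierstrassCurve ℚ} [W'.IsElliptic] [W'.IsGloballyMinimal]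
    (hiso : IsIsogenous W W')
    (hrow : ((∀ [NeZero (W'.conductorNorm ℤ)] (f : CuspForm (Gamma0 (W'.conductorNorm ℤ)) 2),
        IsNewformOf W' f → ∀ (ϖ : ℚ), (ϖ : ℝ) * W'.realPeriodRat = plusPeriod f →
        ‖coeff 1 (C (ϖ : ℚ_[p]) * padicLFunction f (unitRoot W' p : ℚ_[p]))‖ = 1) ∨
      (∃ vc v : ℤ, vc ≠ 0 ∧ AnalyticCoeffOneVal W' p vc ∧
        (∀ Dh : PAdicHeightData W' p, Dh.IsCanonical → v ≤ (padicRegulator Dh).valuation) ∧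
        vc + 1 + 2 * padicValNat p W'.torsionOrder ≤ v + padicValNat p W'.tamagawaProduct + 2) ∨
      (∃ vc v : ℤ, vc ≠ 0 ∧ AnalyticCoeffOneVal W' p vc ∧
        (∀ Dh : PAdicHeightData W' p, Dh.IsCanonical → v ≤ (padicRegulator Dh).valuation) ∧
        vc + 1 + 2 * padicValNat p W'.torsionOrder ≤ v + padicValNat p W'.tamagawaProduct + 4 ∧
        ∃ x : W'.sha, x ≠ 0 ∧ p • x = 0))) :
    BSDp W p :=
  hL.bsdp_of_isIsogenous_of_certificateRowSha_two hW16 hS hPR mazur_tate_sigma_exists_odd_holds hmod hmod' hGZK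
    hCassels hCT hiso hrow

/-- **… and at the pair itself, EIGHT BINDERS: an extended row with the anomalous term evaluated ⇒ Mazur's
main conjecture ∧ `BSD(E,p)`.** [cite: Wuthrich2014, Thm. 16 (p. 397)] [cite: BalakrishnanMullerStein2015, Thm. 1.7]
[cite: PerrinRiou1987, §1.4 Cor. 1.8] [cite: SilvermanAEC2009, Thm. X.4.14 and Thm. V.1.1]
[cite: MazurSteinTate2006, Thm. 1.3] -/
theorem Leaf.mazurMainConjecture_and_bsdp_of_certificateRowSha_two'
    (hW16 : Wuthrich2014.charIdeal_dvd_padicLFunction) (hS : Schneider1985_order_charGenerator_odd)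
    (hPR : perrinRiou_rankOne_leadingTerms_odd)
    (hmod : nonempty_modularParametrizationData) (hGZK : rank_eq_analyticRank_of_analyticRank_le_one)
    (hCT : exists_casselsTate_pairing (K := ℚ)) (hL : Leaf W p)
    (hrow : ((∀ [NeZero (W.conductorNorm ℤ)] (f : CuspForm (Gamma0 (W.conductorNorm ℤ)) 2),
        IsNewformOf W f → ∀ (ϖ : ℚ), (ϖ : ℝ) * W.realPeriodRat = plusPeriod f →
        ‖coeff 1 (C (ϖ : ℚ_[p]) * padicLFunction f (unitRoot W p : ℚ_[p]))‖ = 1) ∨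
      (∃ vc v : ℤ, vc ≠ 0 ∧ AnalyticCoeffOneVal W p vc ∧
        (∀ Dh : PAdicHeightData W p, Dh.IsCanonical → v ≤ (padicRegulator Dh).valuation) ∧
        vc + 1 + 2 * padicValNat p W.torsionOrder ≤ v + padicValNat p W.tamagawaProduct + 2) ∨
      (∃ vc v : ℤ, vc ≠ 0 ∧ AnalyticCoeffOneVal W p vc ∧
        (∀ Dh : PAdicHeightData W p, Dh.IsCanonical → v ≤ (padicRegulator Dh).valuation) ∧
        vc + 1 + 2 * padicValNat p W.torsionOrder ≤ v + padicValNat p W.tamagawaProduct + 4 ∧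
        ∃ x : W.sha, x ≠ 0 ∧ p • x = 0))) :
    MazurMainConjecture W p ∧ BSDp W p :=
  hL.mazurMainConjecture_and_bsdp_of_certificateRowSha_two hW16 hS hPR mazur_tate_sigma_exists_odd_holds hmod
    hGZK hCT hrow

end RankOne

end Summit.BirchSwinnertonDyer.Rank1Residual.X1

end
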